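import Literature.ModelTheory.ExponentialFields.RestrictedExp
import Literature.ModelTheory.ExponentialFields.RealExpansionModels
import Mathlib.Analysis.SpecialFunctions.Exp
import HarnessLib

/-!
# Abstract models of `T_{exp↾}` as real closed fields with a restricted exponential

Topic `Literature/ModelTheory/ExponentialFields`.  Wilkie's First Main Theorem for `exp↾[0,1]`
(J. Amer. Math. Soc. 9 (1996); den Besten 2016, Theorem 2.1.1) concerns *arbitrary* models
`k ⊆ K` of `T_{exp↾} = Th(ℝ; +, ·, -, 0, 1, ≤, exp↾[0,1])` (`rexpTheory`, `RestrictedExp.lean`),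
which its proof treats as real closed ordered fields carrying a function `exp↾` with the
first-order properties of the real one (den Besten, §1.1–§1.2, Lemma 2.3.4).  This file is that
algebraisation for the bundled models `M : rexpTheory.ModelType` — the `T_{exp↾}`-analogue of
`RealExpModels.lean`:

* `RexpModel.Carrier M` — the type of `M` with `+, ·, -, 0, 1, ≤` the interpretations of the
  symbols (`OrderedFieldModel.Dom` of the ordered-ring reduct, `OrderedFieldModels.lean`): a
  `Field`, `LinearOrder`, `IsStrictOrderedRing`, and `IsRealClosed` (`RealExpansionModels.lean`),
  carrying `RexpFun` (the interpretation of `exp↾`); `RexpModel.structure_eq`: the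
  `L_{exp↾}`-structure these generate *is* the structure of `M`, whence
  `RexpModel.realize_iff_real` — an `L_{exp↾}`-sentence read through the operations holds iff
  it holds in `ℝ`;
* first-order properties of `exp↾` transferred from `ℝ`: `RexpModel.rexp_eq_zero` (outside
  `[0,1]`), `rexp_zero`, `rexp_add` (functional equation inside `[0,1]`), `one_add_le_rexp`,
  `rexp_mul_one_sub_le_one` (`exp↾ x · (1 - x) ≤ 1`), whence `rexp_pos`, `rexp_le_rexp`.

Nothing here is a named fact.

## References

* M. den Besten, *Wilkie's Theorem and the Uniform Real Schanuel Conjecture*, MSc thesis,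
  Utrecht 2016, §1.1–§1.2, Definition 1.2.2, Lemma 2.3.4. [DenBesten2016]
* A. J. Wilkie, J. Amer. Math. Soc. 9 (1996), Example (A), p. 1053. [WilkieJAMS1996]
* D. Marker, *Model Theory: An Introduction* (2002), §1.2 (reducts). [Marker2002]
-/

noncomputable section

open FirstOrder FirstOrder.Language FirstOrder.Language.Structure
open scoped FirstOrder

namespace Literature.ModelTheory.ExponentialFields

namespace RexpModel

universe w

variable (M : Language.Theory.ModelType.{0, 0, w} rexpTheory)

/-! ### The real closed ordered field underlying a model of `T_{exp↾}` -/

/-- The ordered-ring reduct of `M` (Marker 2002, §1.2); a reducible `def`, not an instance.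
[cite: Marker2002, §1.2] -/
@[reducible] def orderedRingReduct : Language.orderedRing.Structure M :=
  (LHom.sumInl : Language.orderedRing →ᴸ Language.orderedRexpRing).reduct M

/-- A model of `T_{exp↾} = Th(ℝ; +, ·, -, 0, 1, ≤, exp↾)` is a model of that complete theory
(unfolding `rexpTheory`). [folklore] -/
instance model_completeTheory : (M : Type w) ⊨ Language.orderedRexpRing.completeTheory ℝ :=
  M.is_model

/-- **A model of `T_{exp↾}` is, in its ordered-ring reduct, a model of `RCF`** (den Besten 2016,
§1.1; `RealExpansionModels.lean`). [cite: DenBesten2016, Lemma 2.3.4] -/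
instance model_RCF_reduct : @Theory.Model _ M (orderedRingReduct M) Theory.RCF :=
  RealExpansionModel.model_RCF (M := M) LHom.sumInl

/-- Hence, in its ordered-ring reduct, a model of the theory of ordered fields. [folklore] -/
instance model_orderedField_reduct :
    @Theory.Model _ M (orderedRingReduct M) Theory.orderedField :=
  @model_orderedField_of_model_RCF (M : Type w) (orderedRingReduct M) (model_RCF_reduct M)

/-- **The carrier of a model `M` of `T_{exp↾}` as an ordered field**: the type of `M` with
`+, ·, -, 0, 1, ≤` the interpretations of the corresponding symbols (`OrderedFieldModel.Dom` of
the ordered-ring reduct, `OrderedFieldModels.lean`), so that it is a `Field`, a `LinearOrder`,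
an `IsStrictOrderedRing` and `IsRealClosed` by the instances of that file.  (An `abbrev`: all
algebra on a model of `T_{exp↾}` is done on `RexpModel.Carrier M`, which is definitionally the
type of `M`.) [cite: DenBesten2016, §1.1] -/
abbrev Carrier : Type w := @OrderedFieldModel.Dom M (orderedRingReduct M)

/-- A model of `T_{exp↾}` is a field. [cite: DenBesten2016, §1.1] -/
example : Field (Carrier M) := inferInstance

/-- A model of `T_{exp↾}` is a linearly ordered, strictly ordered ring. [cite: DenBesten2016, §1.1] -/
example : IsStrictOrderedRing (Carrier M) := inferInstance

/-- **A model of `T_{exp↾}` is a real closed field** (den Besten 2016, §1.1, Lemma 2.3.4: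
`OrderedFieldModel.isRealClosed`). [cite: DenBesten2016, Lemma 2.3.4] -/
instance instIsRealClosed : IsRealClosed (Carrier M) :=
  @OrderedFieldModel.isRealClosed (M : Type w) (orderedRingReduct M) (model_RCF_reduct M)

/-- `exp↾` on the carrier of `M`: the interpretation of the symbol `exp↾`.
[cite: DenBesten2016, Definition 1.2.2] -/
instance instRexpFun : RexpFun (Carrier M) :=
  ⟨fun a => funMap (L := Language.orderedRexpRing) (M := M)
    (Sum.inr rexpFunc.rexp : Language.orderedRexpRing.Functions 1) ![a]⟩

/-! ### The structure generated by these data is the structure of `M` -/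

/-- The ordered-ring structure generated by `+, ·, -, 0, 1, ≤` of the carrier is the reduct
(`OrderedFieldModel.structure_eq`). [folklore] -/
theorem orderedRing_structure_eq_reduct :
    (Language.orderedRing.instStructure : Language.orderedRing.Structure (Carrier M)) =
      orderedRingReduct M :=
  OrderedFieldModel.structure_eq (M := (M : Type w)) (instM := orderedRingReduct M)

/-- **The `L_{exp↾}`-structure generated by the operations, order and `exp↾` of the carrier is
the structure of `M`.** [folklore] -/
theorem structure_eq :
    (Language.sumStructure Language.orderedRing Language.rexpUnary (Carrier M) :
        Language.orderedRexpRing.Structure M) = M.struc := by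
  refine Language.Structure.ext ?_ ?_
  · funext n f v
    rcases f with f | f
    · show @funMap Language.orderedRing (Carrier M) Language.orderedRing.instStructure _ f v =
        @funMap Language.orderedRing M (orderedRingReduct M) _ f v
      rw [orderedRing_structure_eq_reduct]
      rfl
    · cases f
      show RexpFun.rexp (v 0) = M.struc.funMap (Sum.inr rexpFunc.rexp) v
      have hv : v = ![v 0] := by ext i; fin_cases i; rfl
      conv_rhs => rw [hv]
      rfl
  · funext n r v
    rcases r with r | r
    · show @RelMap Language.orderedRing (Carrier M) Language.orderedRing.instStructure _ r v =
        @RelMap Language.orderedRing M (orderedRingReduct M) _ r v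
      rw [orderedRing_structure_eq_reduct]
      rfl
    · exact r.elim

/-- Truth of an `L_{exp↾}`-sentence in the carrier (for the generated structure) is truth in `M`.
[folklore] -/
theorem realize_sum_iff (σ : Language.orderedRexpRing.Sentence) :
    @Sentence.Realize _ (Carrier M)
        (Language.sumStructure Language.orderedRing Language.rexpUnary (Carrier M)) σ ↔
      (M : Type w) ⊨ σ :=
  iff_of_eq (congrArg (fun S : Language.orderedRexpRing.Structure M =>
    @Sentence.Realize _ M S σ) (structure_eq M))

/-- **Transfer**: an `L_{exp↾}`-sentence, read through the operations of the carrier, holds iff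
it holds in `ℝ` (models of the complete theory `T_{exp↾}`; Mathlib's
`realize_iff_of_model_completeTheory`). [cite: DenBesten2016, §1.1] -/
theorem realize_iff_real (σ : Language.orderedRexpRing.Sentence) :
    @Sentence.Realize _ (Carrier M)
        (Language.sumStructure Language.orderedRing Language.rexpUnary (Carrier M)) σ ↔
      ℝ ⊨ σ :=
  (realize_sum_iff M σ).trans (realize_iff_of_model_completeTheory ℝ M σ)

/-! ### First-order properties of `exp↾` transferred from `ℝ` -/

section Terms

variable {α : Type} {n : ℕ}

/-- The term `exp↾(t)`. [folklore] -/
def termRexp (t : Language.orderedRexpRing.Term α) : Language.orderedRexpRing.Term α :=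
  func (Sum.inr rexpFunc.rexp : Language.orderedRexpRing.Functions 1) ![t]

/-- A ring term regarded as an `L_{exp↾}`-term. [folklore] -/
abbrev ofRing (t : Language.orderedRing.Term α) : Language.orderedRexpRing.Term α :=
  (LHom.sumInl : Language.orderedRing →ᴸ Language.orderedRexpRing).onTerm t

/-- The term `t₁ · t₂` of `L_{exp↾}`. [folklore] -/
def mulT (t₁ t₂ : Language.orderedRexpRing.Term α) : Language.orderedRexpRing.Term α :=
  func (Sum.inl ringFunc.mul : Language.orderedRexpRing.Functions 2) ![t₁, t₂]

variable {R : Type*} [Add R] [Mul R] [Neg R] [Zero R] [One R] [LE R] [RexpFun R]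

/-- Realization of `exp↾(t)`. [folklore] -/
@[simp]
theorem realize_termRexp (t : Language.orderedRexpRing.Term α) (v : α → R) :
    (termRexp t).realize v = RexpFun.rexp (t.realize v) :=
  rfl

/-- Realization of a ring term regarded as an `L_{exp↾}`-term. [folklore] -/
@[simp]
theorem realize_ofRing (t : Language.orderedRing.Term α) (v : α → R) :
    (ofRing t).realize v = t.realize v :=
  LHom.realize_onTerm _ t v

/-- Realization of `t₁ · t₂`. [folklore] -/
@[simp]
theorem realize_mulT (t₁ t₂ : Language.orderedRexpRing.Term α) (v : α → R) :
    (mulT t₁ t₂).realize v = t₁.realize v * t₂.realize v :=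
  rfl

/-- Realization of `t₁ ≤ t₂` in `L_{exp↾}`. [folklore] -/
@[simp]
theorem realize_le (t₁ t₂ : Language.orderedRexpRing.Term (α ⊕ Fin n)) (v : α → R)
    (xs : Fin n → R) :
    (t₁.le t₂).Realize v xs ↔ t₁.realize (Sum.elim v xs) ≤ t₂.realize (Sum.elim v xs) := by
  rw [Term.le, @BoundedFormula.realize_rel₂]
  exact Language.orderedRexpRing.relMap_le _

end Terms

/-- Valuation bookkeeping for one bound variable. [folklore] -/
private theorem snoc_zero {S : Type*} (a : S) :
    (Fin.snoc (default : Fin 0 → S) a : Fin 1 → S) 0 = a := by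
  simp [Fin.snoc]

/-- **`exp↾` vanishes outside `[0,1]`** in every model of `T_{exp↾}` (as in `ℝ`,
`Real.rexp_def`). [cite: DenBesten2016, Definition 1.2.2] -/
theorem rexp_eq_zero {x : Carrier M} (hx : x < 0 ∨ 1 < x) : RexpFun.rexp x = 0 := by
  -- `∀ x, (¬ 0 ≤ x ∨ ¬ x ≤ 1) → exp↾ x = 0`
  have h := (realize_iff_real M
    (∀' ((∼((ofRing 0).le (ofRing &0)) ⊔ ∼((ofRing &0).le (ofRing 1))) ⟹
      (termRexp (ofRing &0) =' ofRing 0)))).2 (by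
    simp only [Sentence.Realize, Formula.Realize, BoundedFormula.realize_all,
      BoundedFormula.realize_imp, BoundedFormula.realize_sup, BoundedFormula.realize_not,
      realize_le, realize_ofRing, Language.orderedRing.realize_zero,
      Language.orderedRing.realize_one, BoundedFormula.realize_bdEqual, realize_termRexp,
      Function.comp_apply, Term.realize_var, Sum.elim_inr, snoc_zero]
    intro y hy
    rw [Real.rexp_def, if_neg (fun h => hy.elim (fun h' => h' h.1) fun h' => h' h.2)])
  simp only [Sentence.Realize, Formula.Realize, BoundedFormula.realize_all,
    BoundedFormula.realize_imp, BoundedFormula.realize_sup, BoundedFormula.realize_not,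
    realize_le, realize_ofRing, Language.orderedRing.realize_zero,
    Language.orderedRing.realize_one, BoundedFormula.realize_bdEqual, realize_termRexp,
    Function.comp_apply, Term.realize_var, Sum.elim_inr, snoc_zero] at h
  exact h x (hx.elim (fun h' => Or.inl (not_le_of_gt h')) fun h' => Or.inr (not_le_of_gt h'))

/-- **`exp↾ 0 = 1`** in every model of `T_{exp↾}`. [cite: DenBesten2016, Definition 1.2.2] -/
theorem rexp_zero : RexpFun.rexp (0 : Carrier M) = 1 := by
  have h := (realize_iff_real M (termRexp (ofRing 0) =' ofRing 1)).2 (by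
    simp only [Sentence.Realize, Formula.Realize, BoundedFormula.realize_bdEqual,
      realize_termRexp, realize_ofRing, Language.orderedRing.realize_zero,
      Language.orderedRing.realize_one]
    rw [Real.rexp_def, if_pos ⟨le_rfl, zero_le_one⟩, Real.exp_zero])
  simp only [Sentence.Realize, Formula.Realize, BoundedFormula.realize_bdEqual,
    realize_termRexp, realize_ofRing, Language.orderedRing.realize_zero,
    Language.orderedRing.realize_one] at h
  exact h

/-- Valuation bookkeeping for two bound variables. [folklore] -/
private theorem snoc_snoc_zero {S : Type*} (a b : S) :
    (Fin.snoc (Fin.snoc (default : Fin 0 → S) a) b : Fin 2 → S) 0 = a := by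
  simp [Fin.snoc]

/-- Valuation bookkeeping for two bound variables. [folklore] -/
private theorem snoc_snoc_one {S : Type*} (a b : S) :
    (Fin.snoc (Fin.snoc (default : Fin 0 → S) a) b : Fin 2 → S) 1 = b := by
  simp [Fin.snoc]

/-- **The functional equation of `exp↾` inside `[0,1]`** in every model of `T_{exp↾}`:
`exp↾ (x + y) = exp↾ x · exp↾ y` for `0 ≤ x`, `0 ≤ y`, `x + y ≤ 1`. [cite: DenBesten2016, §1.2] -/
theorem rexp_add {x y : Carrier M} (hx : 0 ≤ x) (hy : 0 ≤ y) (hxy : x + y ≤ 1) :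
    RexpFun.rexp (x + y) = RexpFun.rexp x * RexpFun.rexp y := by
  have h := (realize_iff_real M
    (∀' ∀' ((((ofRing 0).le (ofRing &0)) ⊓ ((ofRing 0).le (ofRing &1)) ⊓
        ((ofRing (&0 + &1)).le (ofRing 1))) ⟹
      (termRexp (ofRing (&0 + &1)) =' mulT (termRexp (ofRing &0)) (termRexp (ofRing &1)))))).2 (by
    simp only [Sentence.Realize, Formula.Realize, BoundedFormula.realize_all,
      BoundedFormula.realize_imp, BoundedFormula.realize_inf, realize_le, realize_ofRing,
      Language.orderedRing.realize_zero, Language.orderedRing.realize_one,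
      Language.orderedRing.realize_add, BoundedFormula.realize_bdEqual, realize_termRexp,
      realize_mulT, Function.comp_apply, Term.realize_var, Sum.elim_inr, snoc_snoc_zero,
      snoc_snoc_one]
    rintro a b ⟨⟨ha, hb⟩, hab⟩
    have ha1 : a ≤ 1 := by linarith
    have hb1 : b ≤ 1 := by linarith
    rw [Real.rexp_def, if_pos ⟨add_nonneg ha hb, hab⟩, Real.rexp_def, if_pos ⟨ha, ha1⟩,
      Real.rexp_def, if_pos ⟨hb, hb1⟩, Real.exp_add])
  simp only [Sentence.Realize, Formula.Realize, BoundedFormula.realize_all,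
    BoundedFormula.realize_imp, BoundedFormula.realize_inf, realize_le, realize_ofRing,
    Language.orderedRing.realize_zero, Language.orderedRing.realize_one,
    Language.orderedRing.realize_add, BoundedFormula.realize_bdEqual, realize_termRexp,
    realize_mulT, Function.comp_apply, Term.realize_var, Sum.elim_inr, snoc_snoc_zero,
    snoc_snoc_one] at h
  exact h x y ⟨⟨hx, hy⟩, hxy⟩

/-- **`1 + x ≤ exp↾ x` on `[0,1]`** in every model of `T_{exp↾}` (transfer of
`Real.add_one_le_exp`). [cite: DenBesten2016, §1.2] -/
theorem one_add_le_rexp {x : Carrier M} (h0 : 0 ≤ x) (h1 : x ≤ 1) : 1 + x ≤ RexpFun.rexp x := by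
  have h := (realize_iff_real M
    (∀' ((((ofRing 0).le (ofRing &0)) ⊓ ((ofRing &0).le (ofRing 1))) ⟹
      (ofRing (1 + &0)).le (termRexp (ofRing &0))))).2 (by
    simp only [Sentence.Realize, Formula.Realize, BoundedFormula.realize_all,
      BoundedFormula.realize_imp, BoundedFormula.realize_inf, realize_le, realize_ofRing,
      Language.orderedRing.realize_zero, Language.orderedRing.realize_one,
      Language.orderedRing.realize_add, realize_termRexp, Function.comp_apply,
      Term.realize_var, Sum.elim_inr, snoc_zero]
    rintro a ⟨ha0, ha1⟩
    rw [Real.rexp_def, if_pos ⟨ha0, ha1⟩, add_comm]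
    exact Real.add_one_le_exp a)
  simp only [Sentence.Realize, Formula.Realize, BoundedFormula.realize_all,
    BoundedFormula.realize_imp, BoundedFormula.realize_inf, realize_le, realize_ofRing,
    Language.orderedRing.realize_zero, Language.orderedRing.realize_one,
    Language.orderedRing.realize_add, realize_termRexp, Function.comp_apply,
    Term.realize_var, Sum.elim_inr, snoc_zero] at h
  exact h x ⟨h0, h1⟩

/-- **`exp↾ x · (1 - x) ≤ 1` on `[0,1]`** in every model of `T_{exp↾}` (transfer of
`1 - x ≤ exp (-x)`); with `one_add_le_rexp` this pins `exp↾` between `1 + x` and `1/(1 - x)`.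
[cite: DenBesten2016, §1.2] -/
theorem rexp_mul_one_sub_le_one {x : Carrier M} (h0 : 0 ≤ x) (h1 : x ≤ 1) :
    RexpFun.rexp x * (1 + -x) ≤ 1 := by
  have h := (realize_iff_real M
    (∀' ((((ofRing 0).le (ofRing &0)) ⊓ ((ofRing &0).le (ofRing 1))) ⟹
      (mulT (termRexp (ofRing &0)) (ofRing (1 + -&0))).le (ofRing 1)))).2 (by
    simp only [Sentence.Realize, Formula.Realize, BoundedFormula.realize_all,
      BoundedFormula.realize_imp, BoundedFormula.realize_inf, realize_le, realize_ofRing,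
      Language.orderedRing.realize_zero, Language.orderedRing.realize_one,
      Language.orderedRing.realize_add, Language.orderedRing.realize_neg, realize_termRexp,
      realize_mulT, Function.comp_apply, Term.realize_var, Sum.elim_inr, snoc_zero]
    rintro a ⟨ha0, ha1⟩
    rw [Real.rexp_def, if_pos ⟨ha0, ha1⟩]
    have h1 : 1 + -a ≤ Real.exp (-a) := by
      have := Real.add_one_le_exp (-a)
      linarith
    have h2 : Real.exp a * Real.exp (-a) = 1 := by
      rw [← Real.exp_add, add_neg_cancel, Real.exp_zero]
    nlinarith [Real.exp_pos a])
  simp only [Sentence.Realize, Formula.Realize, BoundedFormula.realize_all,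
    BoundedFormula.realize_imp, BoundedFormula.realize_inf, realize_le, realize_ofRing,
    Language.orderedRing.realize_zero, Language.orderedRing.realize_one,
    Language.orderedRing.realize_add, Language.orderedRing.realize_neg, realize_termRexp,
    realize_mulT, Function.comp_apply, Term.realize_var, Sum.elim_inr, snoc_zero] at h
  exact h x ⟨h0, h1⟩

/-- **`exp↾` is positive on `[0,1]`** in every model of `T_{exp↾}`. [cite: DenBesten2016, §1.2] -/
theorem rexp_pos {x : Carrier M} (h0 : 0 ≤ x) (h1 : x ≤ 1) : 0 < RexpFun.rexp x :=
  lt_of_lt_of_le (lt_of_lt_of_le zero_lt_one (le_add_of_nonneg_right h0))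
    (one_add_le_rexp M h0 h1)

/-- **`exp↾` is monotone on `[0,1]`** in every model of `T_{exp↾}` (from the functional
equation and `1 ≤ exp↾`). [cite: DenBesten2016, §1.2] -/
theorem rexp_le_rexp {x y : Carrier M} (h0 : 0 ≤ x) (hxy : x ≤ y) (h1 : y ≤ 1) :
    RexpFun.rexp x ≤ RexpFun.rexp y := by
  have hd0 : 0 ≤ y - x := sub_nonneg.2 hxy
  have hd1 : y - x ≤ 1 := by linarith
  have hsum : x + (y - x) ≤ 1 := by linarith
  have hfe := rexp_add M h0 hd0 hsum
  rw [add_sub_cancel] at hfe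
  rw [hfe]
  have h1x : x ≤ 1 := hxy.trans h1
  have hpx : 0 < RexpFun.rexp x := rexp_pos M h0 h1x
  have hge : 1 ≤ RexpFun.rexp (y - x) :=
    le_trans (le_add_of_nonneg_right hd0) (one_add_le_rexp M hd0 hd1)
  nlinarith

end RexpModel

end Literature.ModelTheory.ExponentialFields
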